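import Literature.AlgebraicGeometry.Resolution.CoefficientIdealRestriction
import Literature.AlgebraicGeometry.Resolution.HasseSchmidtDerivatives
import Literature.AlgebraicGeometry.Resolution.OriginLocalRing
import Mathlib.RingTheory.PowerSeries.Inverse
import HarnessLib

/-!
# Restriction of the coefficient ideal to a hypersurface in EVERY characteristic, via a transverse Hasse–Schmidt derivation (Bravo–García-Escamilla–Villamayor 2012, Prop. 6.9; Hironaka 2017, Th. 3.10)

Topic: `Literature/AlgebraicGeometry/Resolution`. Characteristic-free companion of
`CoefficientIdealRestriction.lean`, whose algebraic core
`Derivation.mem_pow_of_forall_iterate_mem_sup` ("`δ u = 1`, `δ^i f ∈ 𝔪^{m-i} + (u)` for all `i < m`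
`⇒ f ∈ 𝔪^m`") needs `1, …, m − 1` to be units, because the Leibniz rule of an ordinary derivation
produces the factor `i + 1` in `δ^{i+1}(g u) = δ^{i+1}(g) u + (i+1) δ^i(g)`. In positive
characteristic the SAME statement holds with the iterates `δ^i` replaced by the components `D_i` of a
**Hasse–Schmidt derivation** (higher derivation: `D_0 = id`, `D_n(fg) = Σ_{i+j=n} D_i f · D_j g`)
which is transverse to the hypersurface, `D_1 u` a unit — no division by integers occurs, because
the higher Leibniz rule `D_{i+1}(g u) = D_{i+1}(g)·u + D_i(g)·D_1(u) + Σ_{j≥2} D_{i+1-j}(g)·D_j(u)`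
has the coefficient `D_1 u` (a unit) in place of `i + 1`, and the extra terms involve LOWER
components of `g`, handled by a strong induction.

This is the algebraic content, at a closed point and for a hypersurface, of

* Bravo–García-Escamilla–Villamayor, *On Rees algebras and invariants for singularities over
  perfect fields*, Indiana Univ. Math. J. 61 (2012), **Prop. 6.9** (the "restriction property"):
  "Let `X ⊂ V` be a smooth closed subscheme. Set `𝒳 = 𝒪_V[I(X)W]` and let `𝒢` be an arbitrary Rees
  algebra. Then `𝓕_X((Diff(𝒢))|_X) = 𝓕_V(𝒢) ∩ 𝓕_V(𝒳)`", whose proof (arXiv:1107.1797, pp. 20–21)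
  reduces to `𝒢 = 𝒪_V[fW^b]`, `X = {z_1 = 0}` a hypersurface, and shows at a closed point `x`, with
  the Taylor operators `Δ^j_{z_1}` (`Tay_{z_1} f = Σ_j Δ^j_{z_1}(f) T^j`) in the completion, that
  "`x ∈ Sing(𝒢 ⊙ 𝒳)` if and only if
  `x ∈ Sing(𝒪_{X,x}[(Δ^{b-1}_{z_1} f)|_X W, (Δ^{b-2}_{z_1} f)|_X W², …, f|_X W^b])`";
* Hironaka, *Resolution of singularities in positive characteristics* (manuscript 2017), **Th. 3.10**
  (Ambient Reduction Theorem, p. 10): "`J♯ = Σ_{j=0}^{b-1} (Diff^{(j)}_Z J)^{b♯/(b-j)}` with `b♯ = b!`.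
  For every smooth subscheme `W ⊂ Z` we let `F = (J♯ 𝒪_W, b♯)`. Then `F` is an ambient reduction of
  `E` from `Z` to `W` …" — at stage 0 (no blow-ups) and for a hypersurface `W = V(u)` this says
  `ord_ξ J ≥ b ⇔ ord_ξ (J♯ 𝒪_W) ≥ b!`, which is `Ideal.le_pow_iff_sharp_le_sup` below. (The
  manuscript is unrefereed and under adjudication by the repair cell `pub-hironaka`; Th. 3.10 is one
  of its statements that IS covered in print, by [BGV12] Prop. 6.9 — this file kernel-checks its
  pointwise content in every characteristic. Nothing here bears on the manuscript's later sections.)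

Here the argument is carried out WITHOUT completions and without coordinates, for an abstract
Hasse–Schmidt derivation over any base semiring `R` on any commutative `R`-algebra `A`:

* `HasseSchmidtDerivation R A` — the structure (`D.op n : A →ₗ[R] A`, `D.op 0 = id`, higher
  Leibniz rule over `Finset.antidiagonal n`); `isDiffOpLE_op` — **`D_n` is a differential operator
  of order `≤ n`** (Grothendieck's recursive sense, `DifferentialOperators.lean`), hence
  `apply_mem_diffIdeal` (`D_n f ∈ Diff^{≤ n}(I)` for `f ∈ I`) and `apply_mem_pow_sub`
  (`f ∈ P^m ⇒ D_n f ∈ P^{m-n}`);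
* **`mem_pow_of_forall_apply_mem_sup`** — THE CORE, every characteristic: `u ∈ P`, `D_1 u` a unit,
  `D_i f ∈ P^{m-i} + (u)` for all `i < m` `⇒ f ∈ P^m`; with the converse, **`mem_pow_iff`**:
  `f ∈ P^m ⇔ ∀ i < m, D_i f ∈ P^{m-i} + (u)` ("`ord_x f ≥ m ⇔ ord_x((Δ^i_z f)|_X) ≥ m - i` for
  `i < m`");
* **`Ideal.le_pow_iff_forall_diffIdeal_le_sup`** — ideal form with Grothendieck's `Diff^{≤ i}(J)`
  (`diffIdeal`): if some Hasse–Schmidt derivation is transverse to `u ∈ P`, then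
  `J ⊆ P^m ⇔ Diff^{≤ i}(J) ⊆ P^{m-i} + (u)` for all `i < m` — the characteristic-free replacement
  of `Ideal.le_pow_iff_forall_derivIdealIter_le_sup` (iterated first-order derivative ideals,
  `1, …, m-1` units);
* **`Ideal.le_pow_iff_sharp_le_sup`** — Hironaka's packaging in a regular local ring `(A, 𝔪)` with
  `u ∈ 𝔪` and `D_1 u` a unit (then `u ∉ 𝔪²`, `isUnit_op_one_not_mem_sq`):
  `J ⊆ 𝔪^b ⇔ Σ_{i<b} (Diff^{≤ i} J)^{b!/(b-i)} ⊆ 𝔪^{b!} + (u)`, i.e. `ord J ≥ b` iff the image of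
  `J♯` in the regular local ring `A/(u)` has order `≥ b!` (`Ideal.pow_le_pow_mul_sup_span_iff`,
  Matsumura Thm. 14.2);
* the polynomial instance: `hasseDerivAlong R i` — the Hasse–Schmidt derivation
  `(∂/∂x_i)^{(n)} = D^{(n e_i)}` of `R[x_σ]` (`hasseDeriv`, `HasseSchmidtDerivatives.lean`), with
  `(∂/∂x_i)^{(1)} x_i = 1`; hence **`le_idealOfVars_pow_iff_forall_diffIdeal_le_sup`**: for the
  origin `𝔪 = (x_σ)` of affine space over ANY commutative ring and any coordinate hyperplane
  `x_i = 0`, `J ⊆ 𝔪^m ⇔ Diff^{≤ n}(J) ⊆ 𝔪^{m-n} + (x_i)` for all `n < m`.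

## Design notes

* The components are `R`-linear maps so that `IsDiffOpLE R n (D.op n)` makes sense and
  `Diff^{≤ n}(J) ⊇ {D_n f}`; `R`-linearity of all `D_n` amounts to `D_n(R) = 0` for `n ≥ 1`
  (a Hasse–Schmidt derivation of `A` over `R`).
* No iterativity (`D_i ∘ D_j = (i+j choose i) D_{i+j}`) is assumed: the proof never composes
  components.
* Transversality is `IsUnit (D.op 1 u)`; the higher components `D_n u`, `n ≥ 2`, are arbitrary
  (for `u = x_1` and `D = (∂/∂x_1)^{(·)}` they vanish, but after a blow-up or a change of the
  hypersurface they need not, and the core does not care).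
* Existence of a transverse Hasse–Schmidt derivation at a point of a variety smooth over a perfect
  field (EGA IV₄ 16.11.2: the `D_p` along a regular system of parameters) is NOT constructed here
  beyond the polynomial ring; the abstract theorems take `D` as a hypothesis, exactly as
  `CoefficientIdealRestriction.lean` takes a `CoordSystem`.

## References

* [BravoGarciaEscamillaVillamayor2012] A. Bravo, M. L. García-Escamilla, O. E. Villamayor U.,
  Indiana Univ. Math. J. 61 (2012) 1201–1251 = arXiv:1107.1797: Prop. 6.9 and its proof
  (pp. 20–21 of the arXiv version: `Tay_{z_1}`, `Δ^j_{z_1}`, "`x ∈ Sing(𝒢 ⊙ 𝒳)` iff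
  `ν_x(h_i) ≥ b - i` for `i = 0, …, b-1`"); §6 l. 6–8: "This also appears as the restriction
  property in [Hironaka05]."
* [Hironaka2017] H. Hironaka, manuscript (2017), Th. 3.10 p. 10, Rem. 3.13 p. 11 (unrefereed).
* [VillamayorU2008ReesDiff] O. Villamayor U., Rev. Mat. Iberoam. 24 (2008) = arXiv:math/0606795,
  §2.6 (Taylor operators `Δ^α`), §4.1, Def. 4.2 (coefficients), Thm. 6.13.
* [Giraud1975] J. Giraud, *Contact maximal en caractéristique positive*, Ann. Sci. ÉNS 8 (1975)
  201–234 (Hasse–Schmidt derivations in the theory of maximal contact in characteristic `p`).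
* [Matsumura1987] H. Matsumura, *Commutative Ring Theory*, Thm. 14.2; §27 (higher derivations).
* [BierstoneGrigorievMilmanWlodarczyk2011] Lemma 3.9.4 (the characteristic-zero statement treated
  in `CoefficientIdealRestriction.lean`).
-/

open IsLocalRing MvPolynomial

namespace Literature.AlgebraicGeometry.Resolution

section General

variable (R : Type*) (A : Type*) [CommSemiring R] [CommRing A] [Algebra R A]

/-- **A Hasse–Schmidt derivation** (higher derivation) of the `R`-algebra `A`: a sequence of
`R`-linear endomorphisms `D_n = D.op n` of `A` with `D_0 = id` and the higher Leibniz rule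
`D_n(f g) = Σ_{i+j=n} D_i f · D_j g`. (No iterativity condition.) Example: the divided powers
`(∂/∂x_i)^{(n)}` on a polynomial ring (`hasseDerivAlong`), Villamayor's Taylor operators `Δ^j_{z}`.
[cite: Matsumura1987, §27 (higher derivations)]
[cite: VillamayorU2008ReesDiff, §2.6 (Tay, Δ^α)] -/
structure HasseSchmidtDerivation where
  /-- The components `D_n : A →ₗ[R] A`. -/
  op : ℕ → (A →ₗ[R] A)
  /-- `D_0 = id`. -/
  op_zero : op 0 = LinearMap.id
  /-- The higher Leibniz rule `D_n(f g) = Σ_{i+j=n} D_i f · D_j g`. -/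
  leibniz : ∀ (n : ℕ) (f g : A),
    op n (f * g) = ∑ p ∈ Finset.antidiagonal n, op p.1 f * op p.2 g

variable {R A}

namespace HasseSchmidtDerivation

variable (D : HasseSchmidtDerivation R A)

/-- `D_0 f = f`. [cite: Matsumura1987, §27] -/
@[simp] theorem op_zero_apply (f : A) : D.op 0 f = f := by
  rw [D.op_zero, LinearMap.id_apply]

/-- **The commutator of `D_n` with a multiplication**: `[D_n, g] = Σ_{i+j=n, i≠0} (D_i g)·D_j`
— a combination of LOWER components (Leibniz rule minus its `i = 0` term).
[cite: EGAIV4, Prop. 16.8.8 (b)] -/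
theorem commMul_op (n : ℕ) (g : A) :
    commMul R (D.op n) g =
      ∑ p ∈ (Finset.antidiagonal n).erase (0, n), D.op p.1 g • D.op p.2 := by
  refine LinearMap.ext fun t => ?_
  have h0 : ((0 : ℕ), n) ∈ Finset.antidiagonal n := by simp
  rw [commMul_apply, D.leibniz, ← Finset.add_sum_erase _ _ h0, LinearMap.sum_apply]
  simp only [op_zero_apply, LinearMap.smul_apply, smul_eq_mul]
  ring

/-- **`D_k` is a differential operator of order `≤ k`** (Grothendieck's recursive sense), in every
characteristic: by induction, `[D_k, g]` is a combination of the `D_j`, `j < k`.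
[cite: EGAIV4, Thm. 16.11.2 (the D_p are differential operators of order ≤ |p|)] -/
theorem isDiffOpLE_op_of_le : ∀ (n k : ℕ), k ≤ n → IsDiffOpLE R n (D.op k)
  | 0, k, hk => by
    obtain rfl : k = 0 := Nat.le_zero.mp hk
    rw [D.op_zero]
    exact isDiffOpLE_id
  | n + 1, k, hk => fun g => by
    rw [commMul_op]
    refine IsDiffOpLE.sum _ fun p hp => IsDiffOpLE.smul _ (isDiffOpLE_op_of_le n p.2 ?_)
    obtain ⟨hne, hp'⟩ := Finset.mem_erase.mp hp
    rw [Finset.mem_antidiagonal] at hp'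
    have h1 : p.1 ≠ 0 := by
      intro h1
      apply hne
      rw [h1, zero_add] at hp'
      exact Prod.ext h1 hp'
    omega

/-- `D_n ∈ Diff^{≤ n}`. [cite: EGAIV4, Thm. 16.11.2] -/
theorem isDiffOpLE_op (n : ℕ) : IsDiffOpLE R n (D.op n) :=
  D.isDiffOpLE_op_of_le n n le_rfl

/-- Hence `D_n f ∈ Diff^{≤ n}(I)` for `f ∈ I`. [cite: VillamayorU2008ReesDiff, §4.1] -/
theorem apply_mem_diffIdeal (n : ℕ) {I : Ideal A} {f : A} (hf : f ∈ I) :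
    D.op n f ∈ diffIdeal R n I :=
  Resolution.apply_mem_diffIdeal R (D.isDiffOpLE_op n) hf

/-- **`D_n` lowers the `P`-adic order by at most `n`**: `f ∈ P^m ⇒ D_n f ∈ P^{m-n}` (truncated
subtraction), for ANY ideal `P`, every characteristic. [cite: VillamayorU2008ReesDiff, Def. 3.3 (4) and §4.1] -/
theorem apply_mem_pow_sub (P : Ideal A) {m : ℕ} {f : A} (hf : f ∈ P ^ m) (n : ℕ) :
    D.op n f ∈ P ^ (m - n) :=
  (D.isDiffOpLE_op n).apply_mem_pow_sub P m hf

/-- A transverse parameter has order exactly one: if `u ∈ 𝔪` and `D_1 u` is a unit of the local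
ring `A` then `u ∉ 𝔪²` (`D_1(𝔪²) ⊆ 𝔪`). [folklore] -/
theorem isUnit_op_one_not_mem_sq [IsLocalRing A] {u : A} (hDu : IsUnit (D.op 1 u)) :
    u ∉ maximalIdeal A ^ 2 := by
  intro hu2
  have h := D.apply_mem_pow_sub (maximalIdeal A) hu2 1
  rw [show 2 - 1 = 1 from rfl, pow_one] at h
  exact h hDu

/-- **The core, every characteristic.** Let `P` be an ideal, `u ∈ P`, and `D` a Hasse–Schmidt
derivation with `D_1 u` a unit. If `D_i f ∈ P^{m-i} + (u)` for every `i < m`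
("`ord((Δ^i f)|_{V(u)}) ≥ m - i`"), then `f ∈ P^m` ("`ord f ≥ m`"). Induction on `m`: write
`f = h + g u` with `h ∈ P^m`; a STRONG induction on `i` using
`D_{i+1}(g u) = D_{i+1}(g) u + D_i(g) D_1(u) + Σ_{j ≥ 2} D_{i+1-j}(g) D_j(u)` shows
`D_i g ∈ P^{m-1-i} + (u)` for `i < m - 1` (the unit `D_1 u` is cancelled — no integer is), so
`g ∈ P^{m-1}` and `f ∈ P^m`. This is the step "`x ∈ Sing(𝒢 ⊙ 𝒳)` iff `ν_x(h_i) ≥ b - i`,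
`i = 0, …, b - 1`" of the proof of [BGV12] Prop. 6.9, done without completion or coordinates.
[cite: BravoGarciaEscamillaVillamayor2012, Prop. 6.9 (proof, hypersurface case)] -/
theorem mem_pow_of_forall_apply_mem_sup {P : Ideal A} {u : A} (hu : u ∈ P)
    (hDu : IsUnit (D.op 1 u)) :
    ∀ (m : ℕ) {f : A}, (∀ i < m, D.op i f ∈ P ^ (m - i) ⊔ Ideal.span {u}) → f ∈ P ^ m := by
  obtain ⟨v, hv⟩ := hDu
  intro m
  induction m with
  | zero => intro f _; simp
  | succ m ih =>
    intro f hf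
    -- `f = h + g u` with `h ∈ P^{m+1}`
    have h0 := hf 0 (Nat.zero_lt_succ m)
    rw [op_zero_apply, Nat.sub_zero] at h0
    obtain ⟨h, hh, w, hw, hfw⟩ := Submodule.mem_sup.mp h0
    obtain ⟨g, rfl⟩ := Ideal.mem_span_singleton'.mp hw
    -- the components of `g` satisfy the hypothesis at level `m` (strong induction on `i`)
    have hg' : ∀ i < m, D.op i g ∈ P ^ (m - i) ⊔ Ideal.span {u} := by
      intro i
      induction i using Nat.strong_induction_on with
      | _ i IH =>
        intro hi
        have hf' := hf (i + 1) (Nat.succ_lt_succ hi)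
        rw [← hfw, map_add, Nat.succ_sub_succ] at hf'
        -- `D_{i+1} h ∈ P^{m-i}`
        have h1 : D.op (i + 1) h ∈ P ^ (m - i) ⊔ Ideal.span {u} := by
          refine Ideal.mem_sup_left ?_
          have := D.apply_mem_pow_sub P hh (i + 1)
          rwa [Nat.succ_sub_succ] at this
        -- hence `D_{i+1}(g u) ∈ P^{m-i} + (u)`
        have h2 : D.op (i + 1) (g * u) ∈ P ^ (m - i) ⊔ Ideal.span {u} := by
          have := sub_mem hf' h1
          rwa [add_sub_cancel_left] at this
        -- expand by the higher Leibniz rule and isolate the term `D_i g · D_1 u`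
        have hmem : ((i, 1) : ℕ × ℕ) ∈ Finset.antidiagonal (i + 1) := by
          rw [Finset.mem_antidiagonal]
        have hsplit : D.op (i + 1) (g * u) = D.op i g * D.op 1 u +
            ∑ p ∈ (Finset.antidiagonal (i + 1)).erase (i, 1), D.op p.1 g * D.op p.2 u := by
          rw [D.leibniz, ← Finset.add_sum_erase _ _ hmem]
        -- every other term lies in `P^{m-i} + (u)`
        have hrest : ∑ p ∈ (Finset.antidiagonal (i + 1)).erase (i, 1),
            D.op p.1 g * D.op p.2 u ∈ P ^ (m - i) ⊔ Ideal.span {u} := by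
          refine Submodule.sum_mem _ fun p hp => ?_
          obtain ⟨hne, hp'⟩ := Finset.mem_erase.mp hp
          rw [Finset.mem_antidiagonal] at hp'
          rcases Nat.lt_or_ge p.2 2 with hlt | hge
          · -- `p.2 = 0` (the value `p.2 = 1` is the excluded index): the term is `D_{i+1} g · u`
            have hp2 : p.2 = 0 := by
              rcases Nat.lt_or_ge p.2 1 with h0' | h1'
              · omega
              · exfalso
                apply hne
                have h21 : p.2 = 1 := by omega
                have h11 : p.1 = i := by omega
                exact Prod.ext h11 h21
            rw [hp2, op_zero_apply]
            exact Ideal.mem_sup_right (Ideal.mul_mem_left _ _ (Ideal.mem_span_singleton_self u))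
          · -- `p.2 ≥ 2`: `p.1 < i`, induction hypothesis, and `P^{m-p.1} ⊆ P^{m-i}`
            have hlt1 : p.1 < i := by omega
            have hIH := IH p.1 hlt1 (by omega)
            have hle : P ^ (m - p.1) ⊔ Ideal.span {u} ≤ P ^ (m - i) ⊔ Ideal.span {u} :=
              sup_le_sup_right (Ideal.pow_le_pow_right (by omega)) _
            exact Ideal.mul_mem_right _ _ (hle hIH)
        have hkey : D.op i g * D.op 1 u ∈ P ^ (m - i) ⊔ Ideal.span {u} := by
          rw [hsplit] at h2
          have := sub_mem h2 hrest
          rwa [add_sub_cancel_right] at this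
        -- cancel the unit `D_1 u`
        have : D.op i g = D.op i g * D.op 1 u * (↑v⁻¹ : A) := by
          rw [← hv, mul_assoc, Units.mul_inv, mul_one]
        rw [this]
        exact Ideal.mul_mem_right _ _ hkey
    -- conclude: `g ∈ P^m`, so `f = h + g u ∈ P^{m+1}`
    have hg : g ∈ P ^ m := ih hg'
    rw [← hfw, pow_succ]
    exact add_mem (by rw [← pow_succ]; exact hh) (Ideal.mul_mem_mul hg hu)

/-- **`ord f ≥ m ⇔ ord((D_i f)|_{V(u)}) ≥ m - i` for all `i < m`**, every characteristic
(`u ∈ P`, `D_1 u` a unit); `⇒` is `apply_mem_pow_sub`.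
[cite: BravoGarciaEscamillaVillamayor2012, Prop. 6.9 (proof, hypersurface case)] -/
theorem mem_pow_iff {P : Ideal A} {u : A} (hu : u ∈ P) (hDu : IsUnit (D.op 1 u)) {m : ℕ}
    {f : A} : f ∈ P ^ m ↔ ∀ i < m, D.op i f ∈ P ^ (m - i) ⊔ Ideal.span {u} :=
  ⟨fun hf i _ => Ideal.mem_sup_left (D.apply_mem_pow_sub P hf i),
    D.mem_pow_of_forall_apply_mem_sup hu hDu m⟩

/-- Ideal form with the transverse components only: **`J ⊆ P^m ⇔ D_i(J) ⊆ P^{m-i} + (u)` for all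
`i < m`**. [cite: BravoGarciaEscamillaVillamayor2012, Prop. 6.9 (proof, hypersurface case)] -/
theorem le_pow_iff_forall_apply_mem_sup {P : Ideal A} {u : A} (hu : u ∈ P)
    (hDu : IsUnit (D.op 1 u)) (J : Ideal A) {m : ℕ} :
    J ≤ P ^ m ↔ ∀ i < m, ∀ f ∈ J, D.op i f ∈ P ^ (m - i) ⊔ Ideal.span {u} :=
  ⟨fun h i _ _ hf => Ideal.mem_sup_left (D.apply_mem_pow_sub P (h hf) i),
    fun h f hf => D.mem_pow_of_forall_apply_mem_sup hu hDu m fun i hi => h i hi f hf⟩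

/-! ### The Taylor homomorphism `A → A⟦T⟧` and extension to localizations -/

/-- `D_{n+1}(1) = 0`: higher components kill `1` (from `D_{n+1}(1·1)` and induction). [cite: Matsumura1987, §27] -/
theorem op_succ_apply_one : ∀ n : ℕ, D.op (n + 1) (1 : A) = 0 := by
  intro n
  induction n using Nat.strong_induction_on with
  | _ n IH =>
    have h := D.leibniz (n + 1) 1 1
    rw [one_mul] at h
    have h0n : ((0 : ℕ), n + 1) ∈ Finset.antidiagonal (n + 1) := by simp
    have hn0 : (n + 1, 0) ∈ (Finset.antidiagonal (n + 1)).erase (0, n + 1) := by simp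
    rw [← Finset.add_sum_erase _ _ h0n, ← Finset.add_sum_erase _ _ hn0] at h
    have hrest : ∑ p ∈ ((Finset.antidiagonal (n + 1)).erase (0, n + 1)).erase (n + 1, 0),
        D.op p.1 (1 : A) * D.op p.2 1 = 0 := by
      refine Finset.sum_eq_zero fun p hp => ?_
      obtain ⟨hne1, hp⟩ := Finset.mem_erase.mp hp
      obtain ⟨hne2, hp⟩ := Finset.mem_erase.mp hp
      rw [Finset.mem_antidiagonal] at hp
      have h1 : p.1 ≠ 0 := by
        intro h1; apply hne2; exact Prod.ext h1 (by simp [h1] at hp; simpa using hp)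
      have h2 : p.2 ≠ 0 := by
        intro h2; apply hne1; exact Prod.ext (by simp [h2] at hp; simpa using hp) h2
      obtain ⟨m, hm⟩ := Nat.exists_eq_succ_of_ne_zero h1
      rw [hm, IH m (by omega), zero_mul]
    rw [hrest, add_zero, op_zero_apply, one_mul, mul_one] at h
    -- `h : D_{n+1} 1 = D_{n+1} 1 + D_{n+1} 1`
    have h' : D.op (n + 1) (1 : A) + D.op (n + 1) 1 = D.op (n + 1) 1 + 0 := by
      rw [add_zero]; exact h.symm
    exact add_left_cancel h'

/-- A Hasse–Schmidt derivation OVER `R` kills the scalars: `D_{n+1}(r·1) = 0`. [cite: Matsumura1987, §27] -/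
theorem op_succ_algebraMap (n : ℕ) (r : R) : D.op (n + 1) (algebraMap R A r) = 0 := by
  rw [Algebra.algebraMap_eq_smul_one, map_smul, op_succ_apply_one, smul_zero]

/-- **The Taylor homomorphism** `f ↦ Σ_n D_n(f) T^n : A →+* A⟦T⟧` of a Hasse–Schmidt derivation
(multiplicativity = the higher Leibniz rule; `D_0 = id` = augmentation). [cite: Matsumura1987, §27 (higher derivations as ring homomorphisms into A[[t]])] -/
noncomputable def taylorHom : A →+* PowerSeries A where
  toFun f := PowerSeries.mk fun n => D.op n f
  map_one' := by
    ext n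
    rw [PowerSeries.coeff_mk, PowerSeries.coeff_one]
    cases n with
    | zero => rw [if_pos rfl, op_zero_apply]
    | succ n => rw [op_succ_apply_one, if_neg (Nat.succ_ne_zero n)]
  map_mul' f g := by
    ext n
    simp only [PowerSeries.coeff_mk, PowerSeries.coeff_mul, D.leibniz]
  map_zero' := by
    ext n
    simp only [PowerSeries.coeff_mk, map_zero]
  map_add' f g := by
    ext n
    simp only [PowerSeries.coeff_mk, map_add]

/-- Coefficients of the Taylor homomorphism. [cite: Matsumura1987, §27] -/
@[simp] theorem coeff_taylorHom (n : ℕ) (f : A) :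
    PowerSeries.coeff n (D.taylorHom f) = D.op n f :=
  show PowerSeries.coeff n (PowerSeries.mk fun m => D.op m f) = D.op n f from
    PowerSeries.coeff_mk _ _

/-- The Taylor homomorphism is the identity modulo `T`. [cite: Matsumura1987, §27] -/
theorem constantCoeff_taylorHom (f : A) : PowerSeries.constantCoeff (D.taylorHom f) = f := by
  rw [← PowerSeries.coeff_zero_eq_constantCoeff_apply, coeff_taylorHom, op_zero_apply]

/-- Scalars go to constants. [cite: Matsumura1987, §27] -/
theorem taylorHom_algebraMap (r : R) :
    D.taylorHom (algebraMap R A r) = PowerSeries.C (algebraMap R A r) := by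
  ext n
  rw [coeff_taylorHom, PowerSeries.coeff_C]
  cases n with
  | zero => rw [if_pos rfl, op_zero_apply]
  | succ n => rw [op_succ_algebraMap, if_neg (Nat.succ_ne_zero n)]

/-- **Conversely, a ring homomorphism `φ : A → A⟦T⟧` which is the identity modulo `T` and sends
the scalars `R` to constants IS a Hasse–Schmidt derivation over `R`**: `D_n f = ` the coefficient
of `T^n` in `φ f`. [cite: Matsumura1987, §27 (higher derivations ↔ ring homomorphisms A → A[[t]])] -/
noncomputable def ofRingHom (φ : A →+* PowerSeries A)
    (h0 : ∀ f, PowerSeries.constantCoeff (φ f) = f)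
    (hR : ∀ r : R, φ (algebraMap R A r) = PowerSeries.C (algebraMap R A r)) :
    HasseSchmidtDerivation R A where
  op n :=
    { toFun := fun f => PowerSeries.coeff n (φ f)
      map_add' := fun f g => by rw [map_add, map_add]
      map_smul' := fun r f => by
        rw [Algebra.smul_def, map_mul, hR, PowerSeries.coeff_C_mul, RingHom.id_apply,
          Algebra.smul_def] }
  op_zero := LinearMap.ext fun f => by
    simp only [LinearMap.coe_mk, AddHom.coe_mk, LinearMap.id_apply,
      PowerSeries.coeff_zero_eq_constantCoeff_apply, h0]
  leibniz n f g := by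
    simp only [LinearMap.coe_mk, AddHom.coe_mk, map_mul, PowerSeries.coeff_mul]

/-- Components of `ofRingHom` (definitional). [cite: Matsumura1987, §27] -/
@[simp] theorem ofRingHom_op_apply (φ : A →+* PowerSeries A)
    (h0 : ∀ f, PowerSeries.constantCoeff (φ f) = f)
    (hR : ∀ r : R, φ (algebraMap R A r) = PowerSeries.C (algebraMap R A r)) (n : ℕ) (f : A) :
    (ofRingHom φ h0 hR).op n f = PowerSeries.coeff n (φ f) :=
  rfl

section Localization

variable (S : Submonoid A) (B : Type*) [CommRing B] [Algebra A B] [IsLocalization S B]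

/-- The Taylor homomorphism followed by `A⟦T⟧ → B⟦T⟧` inverts `S`: the constant term of the image
of `s` is `s`, a unit of `B = S⁻¹A`. [folklore] -/
theorem isUnit_map_taylorHom (s : S) :
    IsUnit (((PowerSeries.map (algebraMap A B)).comp D.taylorHom) s) := by
  rw [PowerSeries.isUnit_iff_constantCoeff, RingHom.comp_apply,
    ← PowerSeries.coeff_zero_eq_constantCoeff_apply, PowerSeries.coeff_map, coeff_taylorHom,
    op_zero_apply]
  exact IsLocalization.map_units B s

/-- **The Taylor homomorphism extends to the localisation** `B = S⁻¹A → B⟦T⟧` (universal property).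
[cite: Matsumura1987, §27 (extension of higher derivations to localisations)] -/
noncomputable def localizeTaylorHom : B →+* PowerSeries B :=
  IsLocalization.lift (M := S) (D.isUnit_map_taylorHom S B)

/-- The extension restricted to `A`. [folklore] -/
theorem localizeTaylorHom_algebraMap (a : A) :
    D.localizeTaylorHom S B (algebraMap A B a) =
      PowerSeries.map (algebraMap A B) (D.taylorHom a) :=
  IsLocalization.lift_eq (M := S) (D.isUnit_map_taylorHom S B) a

/-- The extension is still the identity modulo `T` (two ring maps `B → B` agreeing on `A`).
[folklore] -/
theorem constantCoeff_localizeTaylorHom (b : B) :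
    PowerSeries.constantCoeff (D.localizeTaylorHom S B b) = b := by
  have h : (PowerSeries.constantCoeff).comp (D.localizeTaylorHom S B) = RingHom.id B := by
    refine IsLocalization.ringHom_ext S ?_
    ext a
    rw [RingHom.comp_apply, RingHom.comp_apply, RingHom.comp_apply, RingHom.id_apply,
      localizeTaylorHom_algebraMap, ← PowerSeries.coeff_zero_eq_constantCoeff_apply,
      PowerSeries.coeff_map, coeff_taylorHom, op_zero_apply]
  exact RingHom.congr_fun h b

variable [Algebra R B] [IsScalarTower R A B]

/-- The extension sends the scalars `R` to constants. [folklore] -/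
theorem localizeTaylorHom_algebraMap_base (r : R) :
    D.localizeTaylorHom S B (algebraMap R B r) = PowerSeries.C (algebraMap R B r) := by
  rw [IsScalarTower.algebraMap_apply R A B, localizeTaylorHom_algebraMap, taylorHom_algebraMap,
    PowerSeries.map_C]

/-- **The Hasse–Schmidt derivation extended to the localisation `S⁻¹A`.**
[cite: Matsumura1987, §27 (extension of higher derivations to localisations)] -/
noncomputable def localize : HasseSchmidtDerivation R B :=
  ofRingHom (D.localizeTaylorHom S B) (D.constantCoeff_localizeTaylorHom S B)
    (D.localizeTaylorHom_algebraMap_base S B)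

/-- **The extension restricts to `D` on `A`**: `D^B_n(a/1) = D_n(a)/1`. [cite: Matsumura1987, §27] -/
theorem localize_op_algebraMap (n : ℕ) (a : A) :
    (D.localize S B).op n (algebraMap A B a) = algebraMap A B (D.op n a) := by
  rw [localize, ofRingHom_op_apply, localizeTaylorHom_algebraMap, PowerSeries.coeff_map,
    coeff_taylorHom]

end Localization

end HasseSchmidtDerivation

/-- **Restriction of the coefficient ideal to a hypersurface, every characteristic** — ideal form
with Grothendieck's `Diff^{≤ i}(J)` (`diffIdeal`): if `u ∈ P` and some Hasse–Schmidt derivation `D`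
of `A/R` has `D_1 u` a unit, then **`J ⊆ P^m ⇔ Diff^{≤ i}(J) ⊆ P^{m-i} + (u)` for all `i < m`**
(`⇒` holds for any `P`, `u`: `diffIdeal_le_pow_sub`; `⇐`: `D_i f ∈ Diff^{≤ i}(J)`). This is
"`x ∈ Sing(𝒢) ∩ X ⇔ x ∈ Sing((Diff 𝒢)|_X)`" for `𝒢 = 𝒢_{(J,m)}` and the hypersurface `X = V(u)`
— the stage-0 content of the restriction property — and the characteristic-free replacement of
`Ideal.le_pow_iff_forall_derivIdealIter_le_sup` (`CoefficientIdealRestriction.lean`, where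
`Diff^{≤ i}` is the iterated first-order derivative ideal and `1, …, m-1` must be units).
[cite: BravoGarciaEscamillaVillamayor2012, Prop. 6.9]
[cite: Hironaka2017, Th. 3.10 (p. 10; unrefereed manuscript, statement covered by BGV12 Prop. 6.9)] -/
theorem Ideal.le_pow_iff_forall_diffIdeal_le_sup (D : HasseSchmidtDerivation R A) {P : Ideal A}
    {u : A} (hu : u ∈ P) (hDu : IsUnit (D.op 1 u)) (J : Ideal A) {m : ℕ} :
    J ≤ P ^ m ↔ ∀ i < m, diffIdeal R i J ≤ P ^ (m - i) ⊔ Ideal.span {u} :=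
  ⟨fun h i _ => (diffIdeal_le_pow_sub R h i).trans le_sup_left,
    fun h _ hf => D.mem_pow_of_forall_apply_mem_sup hu hDu m fun i hi =>
      h i hi (D.apply_mem_diffIdeal i hf)⟩

end General

/-! ### Hironaka's packaging `J♯ = Σ_{i<b} (Diff^{(i)} J)^{b!/(b-i)}` in a regular local ring -/

section Regular

variable (R : Type*) {A : Type*} [CommSemiring R] [CommRing A] [Algebra R A]

/-- **Hironaka's Ambient Reduction Theorem at a closed point, for a hypersurface, every
characteristic**: in a regular local ring `(A, 𝔪)` carrying a Hasse–Schmidt derivation `D` (over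
any base `R`) with `D_1 u` a unit, `u ∈ 𝔪` (so `u ∉ 𝔪²` and `W = V(u)` is a regular hypersurface),
for every `b` (both sides are trivially true for `b = 0`):
**`J ⊆ 𝔪^b ⇔ J♯ ⊆ 𝔪^{b!} + (u)`**, `J♯ = Σ_{i=0}^{b-1} (Diff^{≤ i}(J))^{b!/(b-i)}` — i.e.
`ord_ξ(J) ≥ b ⇔ ord_ξ(J♯ 𝒪_W) ≥ b!`, "`ξ ∈ Sing(J, b) ⇔ ξ ∈ Sing(J♯ 𝒪_W, b♯)`, `b♯ = b!`"
(the exponents `b!/(b-i)` equalise the marks `b - i`; `Ideal.pow_le_pow_mul_sup_span_iff`, the order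
function of the regular local ring `A/(u)`).
[cite: Hironaka2017, Th. 3.10 (p. 10, J♯ and F = (J♯ O_W, b!); unrefereed manuscript — stage-0 hypersurface case, covered by BGV12 Prop. 6.9)]
[cite: BravoGarciaEscamillaVillamayor2012, Prop. 6.9] -/
theorem Ideal.le_pow_iff_sharp_le_sup [IsRegularLocalRing A] (D : HasseSchmidtDerivation R A)
    {u : A} (hu : u ∈ maximalIdeal A) (hDu : IsUnit (D.op 1 u)) (J : Ideal A) (b : ℕ) :
    J ≤ maximalIdeal A ^ b ↔
      ∑ i ∈ Finset.range b, diffIdeal R i J ^ (b.factorial / (b - i)) ≤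
        maximalIdeal A ^ b.factorial ⊔ Ideal.span {u} := by
  have hu2 : u ∉ maximalIdeal A ^ 2 := D.isUnit_op_one_not_mem_sq hDu
  rw [Ideal.le_pow_iff_forall_diffIdeal_le_sup D hu hDu J, Ideal.sum_eq_sup, Finset.sup_le_iff]
  refine forall_congr' fun i => ?_
  rw [Finset.mem_range]
  refine imp_congr_right fun hi => ?_
  have he : 0 < b.factorial / (b - i) :=
    Nat.div_pos (Nat.le_of_dvd (Nat.factorial_pos b) (Nat.dvd_factorial (by omega) (by omega)))
      (by omega)
  have hmul : b.factorial / (b - i) * (b - i) = b.factorial :=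
    Nat.div_mul_cancel (Nat.dvd_factorial (by omega) (by omega))
  rw [← Ideal.pow_le_pow_mul_sup_span_iff hu hu2 (diffIdeal R i J) (p := b - i) he, hmul]

end Regular

/-! ### The polynomial ring: `(∂/∂x_i)^{(n)}` and the criterion at the origin of affine space -/

section Polynomial

variable {σ : Type*} (R : Type*) [CommRing R] [DecidableEq σ]

/-- **The Hasse–Schmidt derivation `(∂/∂x_i)^{(·)}` of `R[x_σ]` along the `i`-th coordinate**:
`D_n = D^{(n e_i)}`, the coefficient of `u_i^n` in `f(x + u)` (`hasseDeriv R (single i n)`); the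
higher Leibniz rule is `hasseDeriv_mul` restricted to the antidiagonal of `n e_i`
(`Finsupp.antidiagonal_single`). [cite: VillamayorU2008ReesDiff, §2.6 (Δ^α)]
[cite: EGAIV4, Thm. 16.11.2 ((16.11.2.1)-(16.11.2.2))] -/
noncomputable def hasseDerivAlong (i : σ) : HasseSchmidtDerivation R (MvPolynomial σ R) where
  op n := hasseDeriv R (Finsupp.single i n)
  op_zero := by rw [Finsupp.single_zero]; exact hasseDeriv_zero R
  leibniz n f g := by
    rw [hasseDeriv_mul, Finsupp.antidiagonal_single, Finset.sum_map]
    rfl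

/-- The components of `hasseDerivAlong R i` (definitional). [cite: VillamayorU2008ReesDiff, §2.6] -/
@[simp] theorem hasseDerivAlong_op (i : σ) (n : ℕ) :
    (hasseDerivAlong R i).op n = hasseDeriv R (Finsupp.single i n) :=
  rfl

/-- **Transversality to the coordinate hyperplane**: `(∂/∂x_i)^{(1)} x_i = 1`.
[cite: EGAIV4, Thm. 16.11.2 ((16.11.2.1): D_p(z^q) = (q choose p) z^{q-p})] -/
theorem hasseDerivAlong_op_one_X (i : σ) :
    (hasseDerivAlong R i).op 1 (X i : MvPolynomial σ R) = 1 := by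
  have h := hasseDeriv_X_pow R i 1 1 (σ := σ)
  rw [pow_one, Nat.choose_self, Nat.cast_one, Nat.sub_self, pow_zero, mul_one] at h
  rw [hasseDerivAlong_op, h]

/-- **The criterion at the origin of affine space along a coordinate hyperplane, every
characteristic, any commutative base ring**: for `𝔪 = (x_j)_{j ∈ σ}` and any `i ∈ σ`,
`J ⊆ 𝔪^m ⇔ Diff^{≤ n}(J) ⊆ 𝔪^{m-n} + (x_i)` for all `n < m` — "`0 ∈ Sing(J, m)` iff
`0 ∈ Sing((Diff^{≤ n} J)|_{x_i = 0}, m - n)` for all `n < m`".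
[cite: BravoGarciaEscamillaVillamayor2012, Prop. 6.9 (hypersurface case)] -/
theorem le_idealOfVars_pow_iff_forall_diffIdeal_le_sup (i : σ) (J : Ideal (MvPolynomial σ R))
    (m : ℕ) :
    J ≤ idealOfVars σ R ^ m ↔
      ∀ n < m, diffIdeal R n J ≤ idealOfVars σ R ^ (m - n) ⊔ Ideal.span {X i} := by
  refine Ideal.le_pow_iff_forall_diffIdeal_le_sup (hasseDerivAlong R i) ?_ ?_ J
  · exact Ideal.subset_span ⟨i, rfl⟩
  · rw [hasseDerivAlong_op_one_X]; exact isUnit_one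

/-- The same with the transverse components only: **`J ⊆ 𝔪^m ⇔ (∂/∂x_i)^{(n)}(J) ⊆ 𝔪^{m-n} + (x_i)`
for all `n < m`** — one transverse direction suffices.
[cite: BravoGarciaEscamillaVillamayor2012, Prop. 6.9 (proof: the operators Δ^j_{z_1} alone)] -/
theorem le_idealOfVars_pow_iff_forall_hasseDeriv_mem_sup (i : σ) (J : Ideal (MvPolynomial σ R))
    (m : ℕ) :
    J ≤ idealOfVars σ R ^ m ↔ ∀ n < m, ∀ f ∈ J,
      hasseDeriv R (Finsupp.single i n) f ∈ idealOfVars σ R ^ (m - n) ⊔ Ideal.span {X i} := by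
  refine (hasseDerivAlong R i).le_pow_iff_forall_apply_mem_sup ?_ ?_ J
  · exact Ideal.subset_span ⟨i, rfl⟩
  · rw [hasseDerivAlong_op_one_X]; exact isUnit_one

/-! ### The local ring of affine space at the origin: Hironaka's `J♯` formula, every characteristic -/

/-- `x_i` lies in the maximal ideal of `k[x]_{(x)}`. [folklore] -/
theorem algebraMap_X_mem_maximalIdeal_originLocalization (k : Type*) [Field k] (n : ℕ) (i : Fin n) :
    algebraMap (MvPolynomial (Fin n) k) (OriginLocalization k n) (X i) ∈
      maximalIdeal (OriginLocalization k n) := by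
  rw [IsLocalization.AtPrime.to_map_mem_maximal_iff (OriginLocalization k n) (originIdeal k n)]
  rw [mem_originIdeal_iff, constantCoeff_X]

/-- **Hironaka's Ambient Reduction formula at the origin of affine space, for a coordinate
hyperplane, in EVERY characteristic**: for a field `k` (any characteristic), `A = k[x₁,…,xₙ]_{(x)}`
(a regular local ring), an ideal `J ⊆ A`, `b ∈ ℕ` and a coordinate `x_i`:
**`J ⊆ 𝔪^b ⇔ Σ_{j<b} (Diff^{≤ j}_{A/k} J)^{b!/(b-j)} ⊆ 𝔪^{b!} + (x_i)`** —
"`0 ∈ Sing(J, b) ⇔ 0 ∈ Sing(J♯ 𝒪_W, b!)`" for `W = {x_i = 0}`, with the Hasse–Schmidt derivation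
`(∂/∂x_i)^{(·)}` extended from `k[x]` to its localisation as the transverse operator.
[cite: Hironaka2017, Th. 3.10 (p. 10; unrefereed manuscript — stage-0 hypersurface case at the origin, covered by BGV12 Prop. 6.9)]
[cite: BravoGarciaEscamillaVillamayor2012, Prop. 6.9 (proof, hypersurface case)] -/
theorem OriginLocalization.le_pow_iff_sharp_le_sup (k : Type*) [Field k] (n : ℕ) (i : Fin n)
    (J : Ideal (OriginLocalization k n)) (b : ℕ) :
    J ≤ maximalIdeal (OriginLocalization k n) ^ b ↔
      ∑ j ∈ Finset.range b, diffIdeal k j J ^ (b.factorial / (b - j)) ≤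
        maximalIdeal (OriginLocalization k n) ^ b.factorial ⊔
          Ideal.span {algebraMap (MvPolynomial (Fin n) k) (OriginLocalization k n) (X i)} := by
  refine Ideal.le_pow_iff_sharp_le_sup k
    ((hasseDerivAlong k i).localize (originIdeal k n).primeCompl (OriginLocalization k n))
    (algebraMap_X_mem_maximalIdeal_originLocalization k n i) ?_ J b
  rw [HasseSchmidtDerivation.localize_op_algebraMap, hasseDerivAlong_op_one_X, map_one]
  exact isUnit_one

/-- The same criterion with `Diff^{≤ j}` and the marks `b - j` (before packaging):
`J ⊆ 𝔪^b ⇔ Diff^{≤ j}_{A/k}(J) ⊆ 𝔪^{b-j} + (x_i)` for all `j < b`, `A = k[x]_{(x)}`, any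
characteristic. [cite: BravoGarciaEscamillaVillamayor2012, Prop. 6.9 (proof, hypersurface case)] -/
theorem OriginLocalization.le_pow_iff_forall_diffIdeal_le_sup (k : Type*) [Field k] (n : ℕ)
    (i : Fin n) (J : Ideal (OriginLocalization k n)) (b : ℕ) :
    J ≤ maximalIdeal (OriginLocalization k n) ^ b ↔
      ∀ j < b, diffIdeal k j J ≤ maximalIdeal (OriginLocalization k n) ^ (b - j) ⊔
        Ideal.span {algebraMap (MvPolynomial (Fin n) k) (OriginLocalization k n) (X i)} := by
  refine Ideal.le_pow_iff_forall_diffIdeal_le_sup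
    ((hasseDerivAlong k i).localize (originIdeal k n).primeCompl (OriginLocalization k n))
    (algebraMap_X_mem_maximalIdeal_originLocalization k n i) ?_ J
  rw [HasseSchmidtDerivation.localize_op_algebraMap, hasseDerivAlong_op_one_X, map_one]
  exact isUnit_one

end Polynomial

end Literature.AlgebraicGeometry.Resolution
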